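import Summits.ValiantsHypothesis.ValiantsHypothesis.Theses.RealTau
import Literature.Computability.AlgebraicComplexity.DepthThreeChasmGKKSProofs
import Literature.Computability.AlgebraicComplexity.RealTauKnownCases

/-!
# Skeleton of line `fischer-powers` for the crux `RealTauRefined` (stmt-ValiantsHypothesis-18101),
# route `RealTau` — lead's reshape r3 (2026-08-17): stubs UNFOLDED, trivial regimes split off the core
# (self-contained variant: landed stubs pasted, see TEMPORARY note below)

`RealTauRefined` (Tavenas 2014, Conj. 3.23): `∃ a, ∀ k m t`, a nonzero `F = Σ_{i<k} Π_{j<m} f_ij`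
with real `t`-sparse `f_ij` has `≤ 2^(a(m+1)) (k+t+2)^a` distinct real zeros.

The line (strategist's `Lines/fischer_powers.lean`, skelvet PASS) moves the crux by two PROVABLE,
shape-preserving (`a ↦ 2a`) normalisations onto its Waring normal form:

* `WaringOnCurve` (proved here as `waringOnCurve_of` from stubs 1a + 1b): a nonzero signed sum of
  `K` `m`-th powers of `K` real linear forms in the monomials `X^(e_0) < … < X^(e_{T-1})` has
  `≤ 2^(a(m+1)) (K+T+2)^a` distinct real zeros, one absolute `a`.  Conjecture-grade (an instance of
  the crux; equivalent to it through the two other stubs).  Reshape r2 splits it by `K`: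
  - `stub_waringSmallK` — `K ≤ 2`: at most `8T` zeros for every `m` (real roots of unity). TRUE, S.  LANDED p150324.
  - `stub_waringDescartes` — every `K`: at most `2·C(T+m-1,m)` zeros (multinomial support + Descartes); settles
    `T ≤ m+1` and `m ≤ 2`. TRUE, S.  LANDED p152433.
  - `stub_waringCore` — `K ≥ 3`, `m ≥ 3`, `T ≥ m+2`: THE OPEN CORE (uniformity in `K`; KPT 2015 Thm. 12
    covers each fixed `K` with `a = O(K³)`).
* `stub_commonSupport` — `WaringOnCurve → EqualPowerSigned`: enumerate the union of the supports
  increasingly (`Finset.orderEmbOfFin`), rewrite each `h_i` as a linear form in the common monomials,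
  re-absorb `(K + KT + 2)^a ≤ (K+T+2)^(2a)`.  TRUE, size M.  LANDED p148489 (wave 1).
* `stub_fischer` — `EqualPowerSigned → (body of RealTauRefined)` (Tavenas 2014 Lemme 3.26 via the tree's
  `fischer_ryser`): `C m! * F = Σ_{i<k} Σ_{S ⊆ [m]} (-1)^(m-|S|) (Σ_{j∈S} f_ij)^m`, `k·2^m` signed
  `m`-th powers of `(mt)`-sparse polynomials; re-absorb `k 2^m + m t + 2 ≤ 2^m (k+t+2)`.  TRUE, size M.  LANDED p148746 (wave 1).
* `RealTauRefined_of : RealTauRefined` — the composition `stub_fischer (stub_commonSupport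
  waringOnCurve_of)`, kernel-checked.

Reshapes r1/r2 (this file) change NO mathematics relative to the strategist's skeleton: the named
`Prop`s `WaringOnCurve`, `EqualPowerSigned`, `CommonSupportStep := WaringOnCurve → EqualPowerSigned`,
`FischerStep := EqualPowerSigned → RealTauRefined` are unfolded into the stub statements, so that the
stub theorem files under `Theorems/` (which may not import `Cruxes/`) state the registered signatures
verbatim without a definitions file (`EqualPowerSigned` body = the antecedent of `stub_fischer`;
`WaringOnCurve` body = the statement of `waringOnCurve_of` = the antecedent of `stub_commonSupport`),
r2 split the former `stub_waringOnCurve` by `K ≤ 2` / `K ≥ 3`, and r3 further removes the Descartes-trivial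
regimes `T ≤ m+1`, `m ≤ 2` from the open core (`stub_waringLargeK` ↦ `stub_waringCore`).

Disproof used (Cruxes/RealTauRefined/Disproof.lean @bc368b3bf8da, all honoured): sparsity kept (`T`
in the base), the factor `2^(a(m+1))` kept (it absorbs Fischer's `2^m`), `K` in the base, `∃ a`-first
quantifier order in all three statements, `≠ 0` guards kept.  No stub is an instance of a landed
Negative lemma (Theorems/RealTauRefined/Negative/LoadBearing.lean, p143063).
-/

noncomputable section

set_option linter.dupNamespace false

/-! ### TEMPORARY (farm staleness, 2026-08-17): verbatim copies of the three LANDED stub files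
(`Theorems/RealTauRealTauRefinedStub{CommonSupport,Fischer,WaringSmallK,WaringDescartes}.lean`, p148489 / p148746 /
p150324 / p152433) in a
private namespace, so that this skeleton elaborates without importing modules the farm has not built yet.
The import-based version is `work/RealTauRefined_r3.lean` in the lead's folder and replaces this file as soon as
the farm catches up.  Nothing below is registered (no `sorry`). -/

namespace Summit.ValiantsHypothesis.ValiantsHypothesis.Cruxes.RealTauRefined.FischerPowers.Landed

open Polynomial Finset
open Literature.Computability.AlgebraicComplexity

/-! #### verbatim copy of `Theorems/RealTauRealTauRefinedStubCommonSupport.lean` (landed) -/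



/-- **Expansion of a polynomial along the increasing enumeration of a superset of its support.**
If `supp p ⊆ S` and `#S = N`, then `p = Σ_{l<N} C (p.coeff (e l)) * X^(e l)` for the increasing
enumeration `e = S.orderEmbOfFin hN : Fin N ↪o ℕ` of `S`. [folklore] -/
theorem eq_sum_C_mul_X_pow_orderEmbOfFin (p : ℝ[X]) {S : Finset ℕ} (hS : p.support ⊆ S) {N : ℕ}
    (hN : S.card = N) :
    p = ∑ l : Fin N, C (p.coeff (S.orderEmbOfFin hN l)) * X ^ (S.orderEmbOfFin hN l : ℕ) := by
  have h1 : p = ∑ n ∈ S, C (p.coeff n) * X ^ n := by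
    conv_lhs => rw [p.as_sum_support_C_mul_X_pow]
    refine Finset.sum_subset hS fun n _ hn => ?_
    rw [notMem_support_iff.mp hn, C_0, zero_mul]
  have h2 := Finset.sum_map Finset.univ (S.orderEmbOfFin hN).toEmbedding
    (fun n => C (p.coeff n) * X ^ n)
  rw [Finset.map_orderEmbOfFin_univ] at h2
  exact h1.trans h2

/-- **Stub `stub_commonSupport` (common support, `WaringOnCurve → EqualPowerSigned`).** If the
Waring-on-the-monomial-curve bound holds with exponent `a`, then every nonzero `Σ_{i<K} ε_i h_i^m`
with `ε_i = ±1` and `T`-sparse real `h_i` has at most `2^(2a(m+1)) (K+T+2)^(2a)` distinct real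
zeros: enumerate `S = ⋃_i supp (h i)` (`#S ≤ K T`) increasingly by `S.orderEmbOfFin rfl`, write
each `h i` as a linear form in the common monomials (`eq_sum_C_mul_X_pow_orderEmbOfFin`), apply the
hypothesis at `(K, m, #S)` and re-absorb `K + K T + 2 ≤ (K+T+2)^2`. -/
theorem stub_commonSupport :
    (∃ a : ℕ, ∀ (K m T : ℕ) (ε : Fin K → ℤˣ) (c : Fin K → Fin T → ℝ) (e : Fin T → ℕ), StrictMono e →
      (∑ i, C (((ε i : ℤ) : ℝ)) * (∑ l, C (c i l) * X ^ (e l)) ^ m) ≠ 0 →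
        (∑ i, C (((ε i : ℤ) : ℝ)) * (∑ l, C (c i l) * X ^ (e l)) ^ m).roots.toFinset.card
          ≤ 2 ^ (a * (m + 1)) * (K + T + 2) ^ a) →
    ∃ a : ℕ, ∀ (K m T : ℕ) (ε : Fin K → ℤˣ) (h : Fin K → Polynomial ℝ),
      (∀ i, (h i).support.card ≤ T) →
        (∑ i, C (((ε i : ℤ) : ℝ)) * h i ^ m) ≠ 0 →
          (∑ i, C (((ε i : ℤ) : ℝ)) * h i ^ m).roots.toFinset.card
            ≤ 2 ^ (a * (m + 1)) * (K + T + 2) ^ a := by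
  rintro ⟨a, ha⟩
  refine ⟨2 * a, fun K m T ε h hT hne => ?_⟩
  classical
  -- the common support `S ⊇ supp (h i)`, `#S ≤ K T`
  obtain ⟨S, hsub, hcard⟩ : ∃ S : Finset ℕ, (∀ i, (h i).support ⊆ S) ∧ S.card ≤ K * T := by
    refine ⟨Finset.univ.biUnion fun i => (h i).support,
      fun i => Finset.subset_biUnion_of_mem (fun i => (h i).support) (Finset.mem_univ i), ?_⟩
    simpa using Finset.card_biUnion_le_card_mul Finset.univ (fun i => (h i).support) T
      fun i _ => hT i
  -- rewrite every `h i` as a linear form in the common monomials `X^(e l)`, `e = S.orderEmbOfFin`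
  have hrw : (∑ i, C (((ε i : ℤ) : ℝ)) * h i ^ m) =
      ∑ i, C (((ε i : ℤ) : ℝ)) *
        (∑ l : Fin S.card, C ((h i).coeff (S.orderEmbOfFin rfl l)) *
          X ^ (S.orderEmbOfFin rfl l : ℕ)) ^ m :=
    Finset.sum_congr rfl fun i _ => by rw [← eq_sum_C_mul_X_pow_orderEmbOfFin (h i) (hsub i) rfl]
  rw [hrw] at hne ⊢
  refine (ha K m S.card ε (fun i l => (h i).coeff (S.orderEmbOfFin rfl l))
    (fun l => S.orderEmbOfFin rfl l) (S.orderEmbOfFin rfl).strictMono hne).trans ?_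
  -- re-absorb: `K + #S + 2 ≤ (K + T + 2)^2` and `a ↦ 2a`
  have hbase : K + S.card + 2 ≤ (K + T + 2) ^ 2 := by nlinarith [hcard]
  calc 2 ^ (a * (m + 1)) * (K + S.card + 2) ^ a
      ≤ 2 ^ (2 * a * (m + 1)) * ((K + T + 2) ^ 2) ^ a :=
        Nat.mul_le_mul
          (Nat.pow_le_pow_right (by norm_num) (Nat.mul_le_mul_right (m + 1) (by omega)))
          (Nat.pow_le_pow_left hbase a)
    _ = 2 ^ (2 * a * (m + 1)) * (K + T + 2) ^ (2 * a) := by rw [← pow_mul]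


/-! #### verbatim copy of `Theorems/RealTauRealTauRefinedStubFischer.lean` (landed) -/



/-- Fischer's identity over `Fin m`, summed over all subsets: for `y : Fin m → A`,
`m! * Π_j y_j = Σ_{S : Finset (Fin m)} (-1)^(m - |S|) (Σ_{j ∈ S} y_j)^m`. -/
theorem fischer_ryser_univ {A : Type*} [CommRing A] (m : ℕ) (y : Fin m → A) :
    (m.factorial : A) * ∏ j, y j =
      ∑ S : Finset (Fin m), (-1 : A) ^ (m - S.card) * (∑ j ∈ S, y j) ^ m := by
  have h := DepthThreeChasm.fischer_ryser y (univ : Finset (Fin m))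
  simp only [Finset.card_univ, Fintype.card_fin, Finset.powerset_univ] at h
  exact h

/-- The sign `Int.negOnePow j ∈ ℤˣ`, cast to `ℝ` and then to a constant polynomial, is `(-1)^j`. -/
theorem C_cast_negOnePow (j : ℕ) :
    C ((((j : ℤ).negOnePow : ℤ) : ℝ)) = (-1 : Polynomial ℝ) ^ j := by
  rw [Int.cast_negOnePow_natCast, map_pow, map_neg, map_one]

/-- The arithmetic re-absorption `2^(a(m+1)) (k 2^m + m t + 2)^a ≤ 2^(2a(m+1)) (k+t+2)^(2a)`. -/
theorem reabsorb_bound (a k m t : ℕ) :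
    2 ^ (a * (m + 1)) * (k * 2 ^ m + m * t + 2) ^ a ≤
      2 ^ (2 * a * (m + 1)) * (k + t + 2) ^ (2 * a) := by
  have hm : m ≤ 2 ^ m := (Nat.lt_two_pow_self).le
  have h1 : 1 ≤ 2 ^ m := Nat.one_le_two_pow
  have hbase : k * 2 ^ m + m * t + 2 ≤ 2 ^ m * (k + t + 2) := by
    have : m * t ≤ 2 ^ m * t := Nat.mul_le_mul_right t hm
    nlinarith
  have hpow : (k * 2 ^ m + m * t + 2) ^ a ≤ 2 ^ (m * a) * (k + t + 2) ^ a := by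
    calc (k * 2 ^ m + m * t + 2) ^ a ≤ (2 ^ m * (k + t + 2)) ^ a := Nat.pow_le_pow_left hbase a
      _ = 2 ^ (m * a) * (k + t + 2) ^ a := by rw [mul_pow, ← pow_mul]
  have hexp : 2 ^ (a * (m + 1)) * 2 ^ (m * a) ≤ 2 ^ (2 * a * (m + 1)) := by
    rw [← pow_add]
    exact Nat.pow_le_pow_right (by norm_num) (by nlinarith)
  have hkt : (k + t + 2) ^ a ≤ (k + t + 2) ^ (2 * a) :=
    Nat.pow_le_pow_right (by omega) (by omega)
  calc 2 ^ (a * (m + 1)) * (k * 2 ^ m + m * t + 2) ^ a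
      ≤ 2 ^ (a * (m + 1)) * (2 ^ (m * a) * (k + t + 2) ^ a) := Nat.mul_le_mul_left _ hpow
    _ = (2 ^ (a * (m + 1)) * 2 ^ (m * a)) * (k + t + 2) ^ a := by ring
    _ ≤ 2 ^ (2 * a * (m + 1)) * (k + t + 2) ^ (2 * a) := Nat.mul_le_mul hexp hkt

/-- **Fischer / Ryser step (Tavenas 2014, Lemme 3.26; `EqualPowerSigned → RealTauRefined`).**
If nonzero signed sums `Σ_{i<K} ε_i h_i^m` of `m`-th powers of real `T`-sparse polynomials have at
most `2^(a(m+1)) (K+T+2)^a` distinct real zeros for one absolute `a`, then nonzero sums of `k`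
products of `m` real `t`-sparse polynomials have at most `2^(a'(m+1)) (k+t+2)^a'` distinct real zeros
for one absolute `a'` (namely `a' = 2a`): `C m! * F = Σ_{i<k} Σ_{S ⊆ [m]} (-1)^(m-|S|) (Σ_{j∈S} f_ij)^m`
is a signed sum of `k 2^m` `m`-th powers of `(m t)`-sparse polynomials with the same roots as `F`,
and `k 2^m + m t + 2 ≤ 2^m (k+t+2)`. -/
theorem stub_fischer :
    (∃ a : ℕ, ∀ (K m T : ℕ) (ε : Fin K → ℤˣ) (h : Fin K → Polynomial ℝ),
      (∀ i, (h i).support.card ≤ T) →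
        (∑ i, C (((ε i : ℤ) : ℝ)) * h i ^ m) ≠ 0 →
          (∑ i, C (((ε i : ℤ) : ℝ)) * h i ^ m).roots.toFinset.card
            ≤ 2 ^ (a * (m + 1)) * (K + T + 2) ^ a) →
    ∃ a : ℕ, ∀ (k m t : ℕ) (f : Fin k → Fin m → Polynomial ℝ), (∀ i j, (f i j).support.card ≤ t) →
      (∑ i, ∏ j, f i j) ≠ 0 →
        (∑ i, ∏ j, f i j).roots.toFinset.card ≤ 2 ^ (a * (m + 1)) * (k + t + 2) ^ a := by
  rintro ⟨a, ha⟩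
  refine ⟨2 * a, ?_⟩
  intro k m t f hf hF
  classical
  -- reindex `Fin k × Finset (Fin m)` by `Fin (k * 2 ^ m)`
  have hcard : Fintype.card (Fin k × Finset (Fin m)) = k * 2 ^ m := by
    simp [Fintype.card_prod, Fintype.card_fin, Fintype.card_finset]
  let σ : Fin k × Finset (Fin m) ≃ Fin (k * 2 ^ m) := Fintype.equivFinOfCardEq hcard
  -- signs `(-1)^(m - |S|)` and inner sums `Σ_{j ∈ S} f i j`, indexed by `n = σ (i, S)`
  let ε : Fin (k * 2 ^ m) → ℤˣ := fun n => ((m - (σ.symm n).2.card : ℕ) : ℤ).negOnePow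
  let h : Fin (k * 2 ^ m) → Polynomial ℝ := fun n => ∑ j ∈ (σ.symm n).2, f (σ.symm n).1 j
  -- each `h n` is `(m t)`-sparse
  have hsupp : ∀ n, (h n).support.card ≤ m * t := by
    intro n
    calc (h n).support.card ≤ ∑ j ∈ (σ.symm n).2, (f (σ.symm n).1 j).support.card :=
          card_support_sum_le _ _
      _ ≤ ∑ _j ∈ (σ.symm n).2, t := sum_le_sum fun j _ => hf _ j
      _ = (σ.symm n).2.card * t := by simp
      _ ≤ m * t := Nat.mul_le_mul_right t (card_finset_fin_le _)
  -- the Fischer identity, summed over `i` and reindexed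
  have hkey : (∑ n, C (((ε n : ℤ) : ℝ)) * h n ^ m) =
      C ((m.factorial : ℕ) : ℝ) * ∑ i, ∏ j, f i j := by
    calc (∑ n, C (((ε n : ℤ) : ℝ)) * h n ^ m)
        = ∑ n, ((-1 : Polynomial ℝ) ^ (m - (σ.symm n).2.card) *
            (∑ j ∈ (σ.symm n).2, f (σ.symm n).1 j) ^ m) := by
          refine sum_congr rfl fun n _ => ?_
          simp only [ε, h, C_cast_negOnePow]
      _ = ∑ p : Fin k × Finset (Fin m),
            (-1 : Polynomial ℝ) ^ (m - p.2.card) * (∑ j ∈ p.2, f p.1 j) ^ m :=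
          Equiv.sum_comp σ.symm (fun p : Fin k × Finset (Fin m) =>
            (-1 : Polynomial ℝ) ^ (m - p.2.card) * (∑ j ∈ p.2, f p.1 j) ^ m)
      _ = ∑ i : Fin k, ∑ S : Finset (Fin m),
            (-1 : Polynomial ℝ) ^ (m - S.card) * (∑ j ∈ S, f i j) ^ m :=
          Fintype.sum_prod_type _
      _ = ∑ i : Fin k, ((m.factorial : ℕ) : Polynomial ℝ) * ∏ j, f i j :=
          sum_congr rfl fun i _ => (fischer_ryser_univ m (f i)).symm
      _ = C ((m.factorial : ℕ) : ℝ) * ∑ i, ∏ j, f i j := by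
          rw [Polynomial.C_eq_natCast, Finset.mul_sum]
  -- nonvanishing and roots of `C m! * F`
  have hm0 : ((m.factorial : ℕ) : ℝ) ≠ 0 := Nat.cast_ne_zero.mpr (Nat.factorial_ne_zero m)
  have hne : (∑ n, C (((ε n : ℤ) : ℝ)) * h n ^ m) ≠ 0 := by
    rw [hkey]
    exact mul_ne_zero (Polynomial.C_ne_zero.mpr hm0) hF
  have hroots : (∑ n, C (((ε n : ℤ) : ℝ)) * h n ^ m).roots = (∑ i, ∏ j, f i j).roots := by
    rw [hkey, Polynomial.roots_C_mul _ hm0]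
  have hb := ha (k * 2 ^ m) m (m * t) ε h hsupp hne
  rw [hroots] at hb
  exact hb.trans (reabsorb_bound a k m t)


/-! #### verbatim copy of `Theorems/RealTauRealTauRefinedStubWaringSmallK.lean` (landed) -/



/-- A linear form in `T` monomials has at most `T` monomials. [folklore] -/
theorem card_support_linForm_le {T : ℕ} (d : Fin T → ℝ) (e : Fin T → ℕ) :
    (∑ l, C (d l) * X ^ (e l)).support.card ≤ T := by
  have h1 : (∑ l, C (d l) * X ^ (e l)).support.card ≤ ∑ l, (C (d l) * X ^ (e l)).support.card :=
    card_support_sum_le univ (fun l => C (d l) * X ^ (e l))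
  have h2 : ∑ l, (C (d l) * X ^ (e l)).support.card ≤ ∑ _l : Fin T, 1 :=
    sum_le_sum fun l _ => (card_support_C_mul_X_pow_le_one (c := d l) (n := e l))
  have h3 : ∑ _l : Fin T, (1 : ℕ) = T := by
    rw [sum_const, card_univ, Fintype.card_fin, smul_eq_mul, mul_one]
  omega

/-- A linear form in `T` monomials has at most `2T` distinct real zeros (Descartes; `≤ 2T - 1` if it
is nonzero, none counted if it is zero since `roots 0 = 0`). [folklore] -/
theorem card_roots_linForm_le {T : ℕ} (d : Fin T → ℝ) (e : Fin T → ℕ) :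
    (∑ l, C (d l) * X ^ (e l)).roots.toFinset.card ≤ 2 * T := by
  by_cases h0 : (∑ l, C (d l) * X ^ (e l)) = 0
  · rw [h0, roots_zero, Multiset.toFinset_zero, card_empty]; exact Nat.zero_le _
  · have h1 := card_roots_toFinset_le_of_card_support h0
    have h2 := card_support_linForm_le d e
    have h3 : 0 < (∑ l, C (d l) * X ^ (e l)).support.card :=
      card_pos.mpr (nonempty_iff_ne_empty.mpr (mt support_eq_empty.mp h0))
    omega

/-- Real `m`-th roots of unity, sign/parity bookkeeping: if `s₀ a^m + s₁ b^m = 0` with signs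
`s₀, s₁ = ±1` and `m ≠ 0`, then `a = b = 0`, or `a + b = 0`, or (`a - b = 0` with opposite signs).
More precisely, in the form used below. [folklore] -/
theorem sign_pow_add_sign_pow_eq_zero {a b s₀ s₁ : ℝ} {m : ℕ} (hm : m ≠ 0)
    (hs₀ : s₀ = 1 ∨ s₀ = -1) (hs₁ : s₁ = 1 ∨ s₁ = -1) (h : s₀ * a ^ m + s₁ * b ^ m = 0) :
    (s₀ = s₁ ∧ Even m ∧ a = 0 ∧ b = 0) ∨ (s₀ = s₁ ∧ Odd m ∧ a + b = 0) ∨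
      (s₀ = -s₁ ∧ a - b = 0) ∨ (s₀ = -s₁ ∧ Even m ∧ a + b = 0) := by
  by_cases hss : s₀ = s₁
  · subst hss
    have hab : a ^ m + b ^ m = 0 := by
      rcases hs₀ with rfl | rfl <;> linarith
    rcases Nat.even_or_odd m with he | ho
    · left
      have ha : 0 ≤ a ^ m := he.pow_nonneg a
      have hb : 0 ≤ b ^ m := he.pow_nonneg b
      have ha0 : a ^ m = 0 := by linarith
      have hb0 : b ^ m = 0 := by linarith
      exact ⟨rfl, he, pow_eq_zero_iff hm |>.mp ha0, pow_eq_zero_iff hm |>.mp hb0⟩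
    · right; left
      have hab' : a ^ m = (-b) ^ m := by rw [ho.neg_pow]; linarith
      rcases (pow_eq_pow_iff_of_ne_zero hm).mp hab' with h1 | ⟨h1, he⟩
      · exact ⟨rfl, ho, by linarith⟩
      · exact absurd he (Nat.not_even_iff_odd.mpr ho)
  · have hneg : s₀ = -s₁ := by
      rcases hs₀ with rfl | rfl <;> rcases hs₁ with rfl | rfl <;>
        first | exact absurd rfl hss | norm_num
    have hab : a ^ m = b ^ m := by
      subst hneg
      rcases hs₁ with rfl | rfl <;> linarith
    rcases (pow_eq_pow_iff_of_ne_zero hm).mp hab with h1 | ⟨h1, he⟩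
    · right; right; left
      exact ⟨hneg, by linarith⟩
    · right; right; right
      exact ⟨hneg, he, by linarith⟩

/-- **Registered stub `stub_waringSmallK` of line `fischer-powers` (the rung `K ≤ 2` of
`WaringOnCurve`).**  For `K ≤ 2` signs `ε_i = ±1`, a real coefficient matrix `c : K × T` and
exponents `e` (monotonicity is part of the registered shape but not used), the polynomial
`G = Σ_{i<K} ε_i (Σ_l c_il X^(e_l))^m`, if nonzero, has at most `8T` distinct real zeros — for every
`m`.  (`K = 2`: real roots of unity put the zeros of `G` among those of `p, q, p+q, p-q`;
`K ≤ 1`: zeros of `h^m` are those of `h`.) [folklore; cf. Tavenas2014 Conj. 3.24, KoiranPortierTavenas2015 Thm. 12] -/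
theorem stub_waringSmallK :
    ∀ (K m T : ℕ) (ε : Fin K → ℤˣ) (c : Fin K → Fin T → ℝ) (e : Fin T → ℕ), K ≤ 2 → StrictMono e →
      (∑ i, C (((ε i : ℤ) : ℝ)) * (∑ l, C (c i l) * X ^ (e l)) ^ m) ≠ 0 →
        (∑ i, C (((ε i : ℤ) : ℝ)) * (∑ l, C (c i l) * X ^ (e l)) ^ m).roots.toFinset.card ≤ 8 * T := by
  intro K m T ε c e hK _he hG
  -- `m = 0`: `G` is a constant
  rcases Nat.eq_zero_or_pos m with rfl | hm
  · have hconst : (∑ i, C (((ε i : ℤ) : ℝ)) * (∑ l, C (c i l) * X ^ (e l)) ^ 0) =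
        C (∑ i, (((ε i : ℤ) : ℝ))) := by
      simp only [pow_zero, mul_one, map_sum]
    rw [hconst, roots_C, Multiset.toFinset_zero, card_empty]
    exact Nat.zero_le _
  have hm0 : m ≠ 0 := Nat.pos_iff_ne_zero.mp hm
  -- `K = 0, 1, 2`
  obtain rfl | rfl | rfl : K = 0 ∨ K = 1 ∨ K = 2 := by omega
  · -- `K = 0`: `G = 0`
    simp at hG
  · -- `K = 1`: zeros of `ε h^m` are zeros of `h`
    set p : ℝ[X] := ∑ l, C (c 0 l) * X ^ (e l) with hp
    have hG1 : (∑ i : Fin 1, C (((ε i : ℤ) : ℝ)) * (∑ l, C (c i l) * X ^ (e l)) ^ m) =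
        C (((ε 0 : ℤ) : ℝ)) * p ^ m := by
      rw [Fin.sum_univ_one]
    have hs : (((ε 0 : ℤ) : ℝ)) ≠ 0 := by
      rcases Int.units_eq_one_or (ε 0) with h | h <;> simp [h]
    rw [hG1, roots_C_mul _ hs, roots_pow, Multiset.toFinset_nsmul _ _ hm0]
    exact (card_roots_linForm_le (c 0) e).trans (by omega)
  · -- `K = 2`
    set p : ℝ[X] := ∑ l, C (c 0 l) * X ^ (e l) with hp
    set q : ℝ[X] := ∑ l, C (c 1 l) * X ^ (e l) with hq
    set s₀ : ℝ := ((ε 0 : ℤ) : ℝ) with hs₀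
    set s₁ : ℝ := ((ε 1 : ℤ) : ℝ) with hs₁
    have hG2 : (∑ i : Fin 2, C (((ε i : ℤ) : ℝ)) * (∑ l, C (c i l) * X ^ (e l)) ^ m) =
        C s₀ * p ^ m + C s₁ * q ^ m := by
      rw [Fin.sum_univ_two]
    rw [hG2] at hG ⊢
    have hs₀' : s₀ = 1 ∨ s₀ = -1 := by
      rcases Int.units_eq_one_or (ε 0) with h | h <;> simp [hs₀, h]
    have hs₁' : s₁ = 1 ∨ s₁ = -1 := by
      rcases Int.units_eq_one_or (ε 1) with h | h <;> simp [hs₁, h]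
    -- the four auxiliary linear forms and their zero counts
    have hadd : p + q = ∑ l, C (c 0 l + c 1 l) * X ^ (e l) := by
      rw [hp, hq, ← sum_add_distrib]
      refine sum_congr rfl fun l _ => ?_
      rw [C_add, add_mul]
    have hsub : p - q = ∑ l, C (c 0 l - c 1 l) * X ^ (e l) := by
      rw [hp, hq, ← sum_sub_distrib]
      refine sum_congr rfl fun l _ => ?_
      rw [C_sub, sub_mul]
    have bp : p.roots.toFinset.card ≤ 2 * T := card_roots_linForm_le (c 0) e
    have bq : q.roots.toFinset.card ≤ 2 * T := card_roots_linForm_le (c 1) e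
    have badd : (p + q).roots.toFinset.card ≤ 2 * T := by
      rw [hadd]; exact card_roots_linForm_le _ e
    have bsub : (p - q).roots.toFinset.card ≤ 2 * T := by
      rw [hsub]; exact card_roots_linForm_le _ e
    -- containment of the zero set
    have hcont : (C s₀ * p ^ m + C s₁ * q ^ m).roots.toFinset ⊆
        p.roots.toFinset ∪ q.roots.toFinset ∪ (p + q).roots.toFinset ∪ (p - q).roots.toFinset := by
      intro x hx
      rw [Multiset.mem_toFinset, mem_roots', IsRoot.def, eval_add, eval_mul, eval_mul, eval_C, eval_C,
        eval_pow, eval_pow] at hx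
      obtain ⟨-, hx⟩ := hx
      simp only [mem_union, Multiset.mem_toFinset, mem_roots', IsRoot.def, eval_add, eval_sub]
      rcases sign_pow_add_sign_pow_eq_zero hm0 hs₀' hs₁' hx with
        ⟨hss, he, ha, hb⟩ | ⟨hss, ho, hab⟩ | ⟨hss, hab⟩ | ⟨hss, he, hab⟩
      · -- equal signs, `m` even: `p x = q x = 0`
        by_cases hp0 : p = 0
        · -- then `G = C s₁ * q^m`, so `q ≠ 0`
          have hq0 : q ≠ 0 := by
            intro hq0; apply hG; rw [hp0, hq0, zero_pow hm0]; simp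
          exact Or.inl (Or.inl (Or.inr ⟨hq0, hb⟩))
        · exact Or.inl (Or.inl (Or.inl ⟨hp0, ha⟩))
      · -- equal signs, `m` odd: `p x + q x = 0`
        by_cases hpq : p + q = 0
        · exfalso; apply hG
          have hq' : q = -p := by linear_combination hpq
          rw [hq', ho.neg_pow, hss]; ring
        · exact Or.inl (Or.inr ⟨hpq, hab⟩)
      · -- opposite signs: `p x - q x = 0`
        by_cases hpq : p - q = 0
        · exfalso; apply hG
          have hq' : q = p := by linear_combination -hpq
          rw [hq', hss]; simp
        · exact Or.inr ⟨hpq, hab⟩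
      · -- opposite signs, `m` even: `p x + q x = 0`
        by_cases hpq : p + q = 0
        · exfalso; apply hG
          have hq' : q = -p := by linear_combination hpq
          rw [hq', he.neg_pow, hss]; simp
        · exact Or.inl (Or.inr ⟨hpq, hab⟩)
    calc (C s₀ * p ^ m + C s₁ * q ^ m).roots.toFinset.card
        ≤ (p.roots.toFinset ∪ q.roots.toFinset ∪ (p + q).roots.toFinset ∪
            (p - q).roots.toFinset).card := card_le_card hcont
      _ ≤ p.roots.toFinset.card + q.roots.toFinset.card + (p + q).roots.toFinset.card +
            (p - q).roots.toFinset.card :=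
          (card_union_le _ _).trans (Nat.add_le_add_right ((card_union_le _ _).trans
            (Nat.add_le_add_right (card_union_le _ _) _)) _)
      _ ≤ 8 * T := by omega


/-! #### verbatim copy of `Theorems/RealTauRealTauRefinedStubWaringDescartes.lean` (landed) -/



/-- A product of terms `C (d l) * X^(e l)` over a multiset of indices is the single term
`C (∏ d) * X^(Σ e)`. [folklore] -/
theorem multiset_prod_map_C_mul_X_pow {T : ℕ} (d : Fin T → ℝ) (e : Fin T → ℕ)
    (s : Multiset (Fin T)) :
    (s.map fun l => C (d l) * X ^ (e l)).prod = C ((s.map d).prod) * X ^ ((s.map e).sum) := by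
  induction s using Multiset.induction_on with
  | empty => simp
  | cons a s ih =>
    rw [Multiset.map_cons, Multiset.prod_cons, ih, Multiset.map_cons, Multiset.prod_cons,
      Multiset.map_cons, Multiset.sum_cons, C_mul, pow_add]
    ring

/-- **Multinomial support.** The `m`-th power of a linear form in the monomials `X^(e_l)` is
supported on the exponents `Σ_{l ∈ k} e_l`, `k` ranging over the size-`m` multisets of indices.
[folklore; multinomial theorem] -/
theorem support_linForm_pow_subset {T : ℕ} (d : Fin T → ℝ) (e : Fin T → ℕ) (m : ℕ) :
    ((∑ l, C (d l) * X ^ (e l)) ^ m).support ⊆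
      ((univ : Finset (Fin T)).sym m).image (fun k => (k.val.map e).sum) := by
  classical
  intro n hn
  rw [Finset.sum_pow] at hn
  by_contra hnot
  refine (Polynomial.mem_support_iff.mp hn) ?_
  rw [finsetSum_coeff]
  refine Finset.sum_eq_zero fun k hk => ?_
  have hterm : ((k.val.countPerms : ℝ[X]) * (k.val.map fun l => C (d l) * X ^ (e l)).prod) =
      C ((k.val.countPerms : ℝ) * (k.val.map d).prod) * X ^ ((k.val.map e).sum) := by
    rw [multiset_prod_map_C_mul_X_pow, ← mul_assoc, ← C_eq_natCast, ← C_mul]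
  rw [hterm, coeff_C_mul_X_pow, if_neg]
  intro hns
  exact hnot (Finset.mem_image.mpr ⟨k, hk, hns.symm⟩)

/-- **`K`-free monomial count of a Waring sum on a monomial curve**: `Σ_{i<K} ε_i (Σ_l c_il X^(e_l))^m`
has at most `C(T+m-1, m)` monomials, for every `K`. [folklore; stars and bars] -/
theorem card_support_waring_le {K m T : ℕ} (ε : Fin K → ℝ) (c : Fin K → Fin T → ℝ)
    (e : Fin T → ℕ) :
    (∑ i, C (ε i) * (∑ l, C (c i l) * X ^ (e l)) ^ m).support.card ≤ Nat.choose (T + m - 1) m := by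
  classical
  set S : Finset ℕ := ((univ : Finset (Fin T)).sym m).image (fun k => (k.val.map e).sum) with hS
  have hsub : (∑ i, C (ε i) * (∑ l, C (c i l) * X ^ (e l)) ^ m).support ⊆ S := by
    intro n hn
    by_contra hnot
    refine (Polynomial.mem_support_iff.mp hn) ?_
    rw [finsetSum_coeff]
    refine Finset.sum_eq_zero fun i _ => ?_
    rw [coeff_C_mul]
    have : ((∑ l, C (c i l) * X ^ (e l)) ^ m).coeff n = 0 :=
      Polynomial.notMem_support_iff.mp fun h => hnot (support_linForm_pow_subset (c i) e m h)
    rw [this, mul_zero]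
  have hcardS : S.card ≤ Nat.choose (T + m - 1) m :=
    calc S.card ≤ ((univ : Finset (Fin T)).sym m).card := Finset.card_image_le
      _ = Fintype.card (Sym (Fin T) m) := by rw [Finset.sym_univ, Finset.card_univ]
      _ = Nat.choose (T + m - 1) m := by rw [Sym.card_sym_eq_choose, Fintype.card_fin]
  exact (Finset.card_le_card hsub).trans hcardS

/-- **Registered stub `stub_waringDescartes` of line `fischer-powers` (the `K`-free Descartes
bound).**  For every `K`, signs `ε_i = ±1`, real coefficients `c : K × T` and exponents `e`, the
polynomial `G = Σ_{i<K} ε_i (Σ_l c_il X^(e_l))^m`, if nonzero, has at most `2·C(T+m-1, m)` distinct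
real zeros (monomial count `≤ C(T+m-1,m)` by the multinomial theorem and stars and bars, then
Descartes' rule).  This settles the regimes `T ≤ m+1` (`C(2m,m) ≤ 4^m`) and `m ≤ 2` (`≤ (T+1)^2`)
of `WaringOnCurve` with `a = 3`; the open core is `K ≥ 3`, `m ≥ 3`, `T ≥ m+2`.
[folklore; cf. Koiran2011 §6 (bound 2kt^m − 1), Tavenas2014 Conj. 3.24] -/
theorem stub_waringDescartes :
    ∀ (K m T : ℕ) (ε : Fin K → ℤˣ) (c : Fin K → Fin T → ℝ) (e : Fin T → ℕ), StrictMono e →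
      (∑ i, C (((ε i : ℤ) : ℝ)) * (∑ l, C (c i l) * X ^ (e l)) ^ m) ≠ 0 →
        (∑ i, C (((ε i : ℤ) : ℝ)) * (∑ l, C (c i l) * X ^ (e l)) ^ m).roots.toFinset.card
          ≤ 2 * Nat.choose (T + m - 1) m := by
  intro K m T ε c e _he hG
  have h1 := card_roots_toFinset_le_of_card_support hG
  have h2 := card_support_waring_le (fun i => (((ε i : ℤ) : ℝ))) c e (m := m)
  have h3 : 0 < (∑ i, C (((ε i : ℤ) : ℝ)) * (∑ l, C (c i l) * X ^ (e l)) ^ m).support.card :=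
    card_pos.mpr (nonempty_iff_ne_empty.mpr (mt support_eq_empty.mp hG))
  omega


end Summit.ValiantsHypothesis.ValiantsHypothesis.Cruxes.RealTauRefined.FischerPowers.Landed

namespace Summit.ValiantsHypothesis.ValiantsHypothesis.Cruxes.RealTauRefined.FischerPowers

open Polynomial Finset
open Literature.Computability.AlgebraicComplexity
open Summit.ValiantsHypothesis.ValiantsHypothesis.Theses.RealTau

/-- **Stub 1a (calibration rung `K ≤ 2` of `WaringOnCurve`, registered `stub_waringSmallK`).**
For `K ≤ 2` powers the Waring-on-curve sum `G = Σ_{i<K} ε_i (Σ_l c_il X^(e_l))^m ≠ 0` has at most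
`8T` distinct real zeros, for every `m` (real roots of unity: the zeros of `ε₀ p^m + ε₁ q^m` lie among
those of the nonzero members of `{p, q, p+q, p-q}`, four linear forms in the same `T` monomials;
`K ≤ 1` is immediate).  TRUE; size S.  LANDED p150324 (lead). -/
theorem stub_waringSmallK :
    ∀ (K m T : ℕ) (ε : Fin K → ℤˣ) (c : Fin K → Fin T → ℝ) (e : Fin T → ℕ), K ≤ 2 → StrictMono e →
      (∑ i, C (((ε i : ℤ) : ℝ)) * (∑ l, C (c i l) * X ^ (e l)) ^ m) ≠ 0 →
        (∑ i, C (((ε i : ℤ) : ℝ)) * (∑ l, C (c i l) * X ^ (e l)) ^ m).roots.toFinset.card ≤ 8 * T :=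
  -- LANDED (lead, p150324): Theorems/RealTauRealTauRefinedStubWaringSmallK.lean
  Summit.ValiantsHypothesis.ValiantsHypothesis.Cruxes.RealTauRefined.FischerPowers.Landed.stub_waringSmallK

/-- **Stub 1b (the `K`-free Descartes bound, registered `stub_waringDescartes`).**  For every `K`,
a nonzero `G = Σ_{i<K} ε_i (Σ_l c_il X^(e_l))^m` has at most `2·C(T+m-1, m)` distinct real zeros:
all `h_i^m` are supported on the same `≤ #Sym (Fin T) m = C(T+m-1,m)` exponents (multinomial
theorem + stars and bars), then Descartes.  Settles the regimes `T ≤ m+1` and `m ≤ 2` of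
`WaringOnCurve` (with `a = 3`).  TRUE; size S.  LANDED p152433 (lead). -/
theorem stub_waringDescartes :
    ∀ (K m T : ℕ) (ε : Fin K → ℤˣ) (c : Fin K → Fin T → ℝ) (e : Fin T → ℕ), StrictMono e →
      (∑ i, C (((ε i : ℤ) : ℝ)) * (∑ l, C (c i l) * X ^ (e l)) ^ m) ≠ 0 →
        (∑ i, C (((ε i : ℤ) : ℝ)) * (∑ l, C (c i l) * X ^ (e l)) ^ m).roots.toFinset.card
          ≤ 2 * Nat.choose (T + m - 1) m :=
  -- LANDED (lead, p152433): Theorems/RealTauRealTauRefinedStubWaringDescartes.lean (pasted above, farm staleness)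
  Summit.ValiantsHypothesis.ValiantsHypothesis.Cruxes.RealTauRefined.FischerPowers.Landed.stub_waringDescartes

/-- **Stub 1c (THE OPEN CORE: `WaringOnCurve` in the regime `K ≥ 3`, `m ≥ 3`, `T ≥ m + 2`,
registered `stub_waringCore`).**  For signs `ε_i = ±1`, a real coefficient matrix `c : K × T` with
`K ≥ 3` rows, `T ≥ m + 2` columns, `m ≥ 3`, and strictly increasing exponents `e_0 < ⋯ < e_{T-1}`,
put `h_i := Σ_l c_il X^(e_l)`.  If `G := Σ_{i<K} ε_i h_i^m ≠ 0` then `G` has at most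
`2^(a(m+1)) (K+T+2)^a` distinct real zeros, for one absolute `a`.  (Tavenas 2014 Conj. 3.24
specialised to equal exponents, unit coefficients and a common sorted support, restricted to the
only regime not covered by `stub_waringSmallK` (K ≤ 2: roots of unity) and `stub_waringDescartes`
(T ≤ m+1 or m ≤ 2: monomial count); conjecture-grade: with those two it is `WaringOnCurve`, an
instance of the crux, and it implies the crux through `stub_commonSupport` and `stub_fischer`.
True for each FIXED `K` with `a = O(K³)` uniformly in `m, T` — Koiran–Portier–Tavenas 2015
Thm. 12 — so its content is uniformity in `K`; true on average — Briquel–Bürgisser 2020.)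
Size: open-problem. -/
theorem stub_waringCore :
    ∃ a : ℕ, ∀ (K m T : ℕ) (ε : Fin K → ℤˣ) (c : Fin K → Fin T → ℝ) (e : Fin T → ℕ), 3 ≤ K → 3 ≤ m →
      m + 2 ≤ T → StrictMono e →
      (∑ i, C (((ε i : ℤ) : ℝ)) * (∑ l, C (c i l) * X ^ (e l)) ^ m) ≠ 0 →
        (∑ i, C (((ε i : ℤ) : ℝ)) * (∑ l, C (c i l) * X ^ (e l)) ^ m).roots.toFinset.card
          ≤ 2 ^ (a * (m + 1)) * (K + T + 2) ^ a := by
  sorry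

/-- **`WaringOnCurve` (proved composition of stubs 1a, 1b, 1c).** A nonzero signed sum of `K` `m`-th
powers of real linear forms in the monomials `X^(e_0) < ⋯ < X^(e_{T-1})` has at most
`2^(a(m+1)) (K+T+2)^a` distinct real zeros, for one absolute `a` (namely `a_{1c} + 3`). -/
theorem waringOnCurve_of :
    ∃ a : ℕ, ∀ (K m T : ℕ) (ε : Fin K → ℤˣ) (c : Fin K → Fin T → ℝ) (e : Fin T → ℕ), StrictMono e →
      (∑ i, C (((ε i : ℤ) : ℝ)) * (∑ l, C (c i l) * X ^ (e l)) ^ m) ≠ 0 →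
        (∑ i, C (((ε i : ℤ) : ℝ)) * (∑ l, C (c i l) * X ^ (e l)) ^ m).roots.toFinset.card
          ≤ 2 ^ (a * (m + 1)) * (K + T + 2) ^ a := by
  obtain ⟨a, ha⟩ := stub_waringCore
  refine ⟨a + 3, fun K m T ε c e he hG => ?_⟩
  have hB : 1 ≤ K + T + 2 := by omega
  have h8 : 8 ≤ 2 ^ ((a + 3) * (m + 1)) :=
    calc (8 : ℕ) = 2 ^ 3 := by norm_num
      _ ≤ 2 ^ ((a + 3) * (m + 1)) := Nat.pow_le_pow_right (by norm_num) (by nlinarith)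
  have hmono : 2 ^ (a * (m + 1)) * (K + T + 2) ^ a ≤ 2 ^ ((a + 3) * (m + 1)) * (K + T + 2) ^ (a + 3) :=
    Nat.mul_le_mul (Nat.pow_le_pow_right (by norm_num) (by nlinarith))
      (Nat.pow_le_pow_right hB (by omega))
  rcases Nat.lt_or_ge K 3 with hK | hK
  · -- `K ≤ 2`: roots of unity
    calc _ ≤ 8 * T := stub_waringSmallK K m T ε c e (by omega) he hG
      _ ≤ 2 ^ ((a + 3) * (m + 1)) * (K + T + 2) ^ (a + 3) := by
        have hT : T ≤ (K + T + 2) ^ (a + 3) :=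
          calc T ≤ K + T + 2 := by omega
            _ ≤ (K + T + 2) ^ (a + 3) := Nat.le_self_pow (by omega) _
        exact Nat.mul_le_mul h8 hT
  rcases Nat.lt_or_ge m 3 with hm | hm
  · -- `m ≤ 2`: monomial count `C(T+m-1, m) ≤ (T+m-1)^m ≤ (K+T+2)^(a+3)`
    calc _ ≤ 2 * Nat.choose (T + m - 1) m := stub_waringDescartes K m T ε c e he hG
      _ ≤ 2 ^ ((a + 3) * (m + 1)) * (K + T + 2) ^ (a + 3) := by
        refine Nat.mul_le_mul (le_trans (by norm_num) h8) ?_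
        calc Nat.choose (T + m - 1) m ≤ (T + m - 1) ^ m := Nat.choose_le_pow _ _
          _ ≤ (K + T + 2) ^ m := Nat.pow_le_pow_left (by omega) _
          _ ≤ (K + T + 2) ^ (a + 3) := Nat.pow_le_pow_right hB (by omega)
  rcases Nat.lt_or_ge T (m + 2) with hT | hT
  · -- `T ≤ m + 1`: monomial count `C(T+m-1, m) ≤ 2^(T+m-1) ≤ 2^(2m)`
    calc _ ≤ 2 * Nat.choose (T + m - 1) m := stub_waringDescartes K m T ε c e he hG
      _ ≤ 2 ^ ((a + 3) * (m + 1)) * (K + T + 2) ^ (a + 3) := by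
        have h1 : Nat.choose (T + m - 1) m ≤ 2 ^ (2 * m) :=
          (Nat.choose_le_two_pow _ _).trans (Nat.pow_le_pow_right (by norm_num) (by omega))
        have h2 : 2 * 2 ^ (2 * m) ≤ 2 ^ ((a + 3) * (m + 1)) := by
          rw [← pow_succ']
          exact Nat.pow_le_pow_right (by norm_num) (by nlinarith)
        have h3 : 1 ≤ (K + T + 2) ^ (a + 3) := Nat.one_le_pow _ _ hB
        calc 2 * Nat.choose (T + m - 1) m ≤ 2 * 2 ^ (2 * m) := Nat.mul_le_mul_left 2 h1
          _ ≤ 2 ^ ((a + 3) * (m + 1)) * 1 := by rw [mul_one]; exact h2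
          _ ≤ 2 ^ ((a + 3) * (m + 1)) * (K + T + 2) ^ (a + 3) := Nat.mul_le_mul_left _ h3
  · -- the open core
    exact (ha K m T ε c e hK hm hT he hG).trans hmono

/-- **Stub 2 (common support, `WaringOnCurve → EqualPowerSigned`).** If the Waring-on-curve bound
holds, then every nonzero `Σ_{i<K} ε_i h_i^m` with `ε_i = ±1` and `T`-sparse real `h_i` has at most
`2^(a(m+1)) (K+T+2)^a` distinct real zeros for one absolute `a`: enumerate `S = ⋃_i supp (h i)`
increasingly by `S.orderEmbOfFin rfl : Fin |S| ↪o ℕ` (`|S| ≤ K T`), write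
`h i = Σ_l C ((h i).coeff (e l)) * X^(e l)` (`Polynomial.as_sum_support_C_mul_X_pow` over
`S ⊇ supp (h i)`), apply the hypothesis at `(K, m, |S|)` and re-absorb
`(K + KT + 2)^a ≤ ((K+T+2)^2)^a`: output exponent `2a`.  TRUE; size M. -/
theorem stub_commonSupport :
    (∃ a : ℕ, ∀ (K m T : ℕ) (ε : Fin K → ℤˣ) (c : Fin K → Fin T → ℝ) (e : Fin T → ℕ), StrictMono e →
      (∑ i, C (((ε i : ℤ) : ℝ)) * (∑ l, C (c i l) * X ^ (e l)) ^ m) ≠ 0 →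
        (∑ i, C (((ε i : ℤ) : ℝ)) * (∑ l, C (c i l) * X ^ (e l)) ^ m).roots.toFinset.card
          ≤ 2 ^ (a * (m + 1)) * (K + T + 2) ^ a) →
    ∃ a : ℕ, ∀ (K m T : ℕ) (ε : Fin K → ℤˣ) (h : Fin K → Polynomial ℝ),
      (∀ i, (h i).support.card ≤ T) →
        (∑ i, C (((ε i : ℤ) : ℝ)) * h i ^ m) ≠ 0 →
          (∑ i, C (((ε i : ℤ) : ℝ)) * h i ^ m).roots.toFinset.card
            ≤ 2 ^ (a * (m + 1)) * (K + T + 2) ^ a :=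
  -- LANDED (wave 1, p148489): Theorems/RealTauRealTauRefinedStubCommonSupport.lean
  Summit.ValiantsHypothesis.ValiantsHypothesis.Cruxes.RealTauRefined.FischerPowers.Landed.stub_commonSupport

/-- **Stub 3 (Fischer / Ryser step, Tavenas 2014 Lemme 3.26; `EqualPowerSigned → RealTauRefined`).**
For `m = 0` the sum is the constant `k` (no roots); for `m ≥ 1`, by the tree's `fischer_ryser`
(with `s = univ : Finset (Fin m)`, `y = f i`) `C m! * F = Σ_{i<k} Σ_{S ⊆ [m]} C((-1)^(m-|S|)) *
(Σ_{j∈S} f i j)^m`; reindex `Fin k × Finset (Fin m)` by `Fin (k * 2^m)` (`Fintype.equivFin`,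
`Fintype.sum_equiv`), bound each support by `card_support_sum_le … ≤ m t`, note
`(C m! * F).roots = F.roots` (`roots_C_mul`, `m! ≠ 0`), apply the hypothesis at `(k 2^m, m, m t)` and
re-absorb `k 2^m + m t + 2 ≤ 2^m (k+t+2)`: output exponent `2a`.  TRUE; size M. -/
theorem stub_fischer :
    (∃ a : ℕ, ∀ (K m T : ℕ) (ε : Fin K → ℤˣ) (h : Fin K → Polynomial ℝ),
      (∀ i, (h i).support.card ≤ T) →
        (∑ i, C (((ε i : ℤ) : ℝ)) * h i ^ m) ≠ 0 →
          (∑ i, C (((ε i : ℤ) : ℝ)) * h i ^ m).roots.toFinset.card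
            ≤ 2 ^ (a * (m + 1)) * (K + T + 2) ^ a) →
    ∃ a : ℕ, ∀ (k m t : ℕ) (f : Fin k → Fin m → Polynomial ℝ), (∀ i j, (f i j).support.card ≤ t) →
      (∑ i, ∏ j, f i j) ≠ 0 →
        (∑ i, ∏ j, f i j).roots.toFinset.card ≤ 2 ^ (a * (m + 1)) * (k + t + 2) ^ a :=
  -- LANDED (wave 1, p148746): Theorems/RealTauRealTauRefinedStubFischer.lean
  Summit.ValiantsHypothesis.ValiantsHypothesis.Cruxes.RealTauRefined.FischerPowers.Landed.stub_fischer

/-- **Composition (proved): the crux BY NAME from the three registered stubs** — the conclusion of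
`stub_fischer` is the body of `RealTauRefined` verbatim (definitional unfolding), so this is the only
declaration of the line whose stated type is the route decl. -/
theorem RealTauRefined_of : RealTauRefined :=
  stub_fischer (stub_commonSupport waringOnCurve_of)

end Summit.ValiantsHypothesis.ValiantsHypothesis.Cruxes.RealTauRefined.FischerPowers
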